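import Mathlib
import HarnessLib
import Summits.QuantumFields.YangMills.Theorems.MirrorModularBoostsHypercubicLimitTiltedDiagonal
import Summits.QuantumFields.YangMills.Theorems.MirrorModularBoostsHypercubicLimitSignPolarisation
import Literature.NumberTheory.Transcendental.CijsouwWaldschmidt1977Points

/-!
# Moment bounds from tilted-derivative bounds (abstract probability)

Helper file 3/4 for stub `stub_derivToMoments` of line `Sketch` (coupling response) of crux `HypercubicLimit`
(stmt-QuantumFields-16154).  For a linear field `Φ : T →ₗ[ℝ] (Ω → ℝ)` of bounded measurable observables on a
probability space, an admissible set of tests closed under normalised sign combinations and a disjointness relation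
closed under linear combinations: uniform bounds `C₀ C₁ⁿ n!` on all real derivatives at `0` of the tilted one-point
functions `t ↦ ∫ Φ f₀ d(μ.tilted (t Φ f₁))` (admissible disjoint pairs) imply `|∫ ∏ᵢ Φ fᵢ dμ| ≤ Dⁿ n!`,
`D = 2C₀ + 2eC₁ + 1`, for admissible pairwise disjoint families — sign polarisation of the symmetric multilinear mixed
coefficients (landed `sum_sign_smul_map_diag_eq_of_symmetric`, `mixedCoeffML_symm`, `mixedCoeff_diagonal`) and the
moment recursion by induction on `n`.
-/

noncomputable section

open MeasureTheory Finset

namespace Summit.QuantumFields.YangMills.Cruxes.HypercubicLimit.CouplingResponse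

/-! ## Moment bounds from tilted-derivative bounds (abstract probability) -/

section Abstract

open ProbabilityTheory

variable {Ω : Type*} [MeasurableSpace Ω] {μ : Measure Ω} [IsProbabilityMeasure μ]
variable {T : Type*} [AddCommGroup T] [Module ℝ T]

/-- A finset of `Fin n` is the image of `univ` under an embedding of `Fin` of its cardinality. [folklore] -/
theorem exists_embedding_map_univ_eq {n k : ℕ} (t : Finset (Fin n)) (h : t.card = k) :
    ∃ e : Fin k ↪ Fin n, (univ : Finset (Fin k)).map e = t :=
  ⟨(t.orderEmbOfFin h).toEmbedding, map_orderEmbOfFin_univ t h⟩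

/-- **The mixed coefficients of a linear field are bounded by polarised tilted-derivative bounds.**  Let
`Φ : T →ₗ[ℝ] (Ω → ℝ)` take bounded measurable values, `Adm ⊆ T` be closed under the normalised sign
combinations `(Σᵢ εᵢ fᵢ)/m`, and `Disj f₀ ·` be closed under linear combinations.  If for all admissible `f₀, f₁`
with `Disj f₀ f₁` every real derivative at `0` of `t ↦ ∫ Φ f₀ d(μ.tilted (t Φ f₁))` is bounded by `C₀ C₁ⁿ n!`, then
for admissible `f₀` and admissible `v₁ … v_m` each `Disj` from `f₀`,
`|A_{Φ f₀}(Φ v₁, …, Φ v_m)| ≤ C₀ (C₁ m)^m`: the diagonal values of the symmetric multilinear form `A` are the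
`m`-th derivatives (`mixedCoeff_const_eq_iteratedDeriv`), and sign polarisation recovers `A` from its diagonal on
the `2^m` combinations `W_ε = (Σ εⱼ Φ vⱼ)/m` (`sum_sign_smul_map_diag_eq_of_symmetric`). [folklore] -/
theorem abs_mixedCoeff_le_of_tilted_deriv_bounds (Φ : T →ₗ[ℝ] Ω → ℝ) (hΦ : ∀ f, IsBddMeas (Φ f))
    (Adm : Set T) (Disj : T → T → Prop)
    (hAdm : ∀ (m : ℕ) (v : Fin m → T) (ε : Fin m → Fin 2), (∀ i, v i ∈ Adm) →
      ((m : ℝ)⁻¹ • ∑ i, (-1 : ℝ) ^ (ε i : ℕ) • v i) ∈ Adm)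
    (hDisj : ∀ (f₀ : T) (m : ℕ) (v : Fin m → T) (c : Fin m → ℝ), (∀ i, Disj f₀ (v i)) →
      Disj f₀ (∑ i, c i • v i))
    {C₀ C₁ : ℝ}
    (hbound : ∀ f₀ f₁, f₀ ∈ Adm → f₁ ∈ Adm → Disj f₀ f₁ → ∀ n : ℕ,
      |iteratedDeriv n (fun t => ∫ ω, Φ f₀ ω ∂(μ.tilted (fun ω => t * Φ f₁ ω))) 0| ≤
        C₀ * C₁ ^ n * n.factorial)
    {f₀ : T} (hf₀ : f₀ ∈ Adm) {m : ℕ} {v : Fin m → T} (hv : ∀ i, v i ∈ Adm)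
    (hd : ∀ i, Disj f₀ (v i)) :
    |mixedCoeff μ (Φ f₀) (fun i => Φ (v i)) univ| ≤ C₀ * (C₁ * m) ^ m := by
  -- the symmetric multilinear packaging
  set Xb : bddMeas Ω := ⟨Φ f₀, hΦ f₀⟩ with hXb
  set vb : Fin m → bddMeas Ω := fun i => ⟨Φ (v i), hΦ (v i)⟩ with hvb
  set F := mixedCoeffML μ Xb m with hF
  have hFv : mixedCoeff μ (Φ f₀) (fun i => Φ (v i)) univ = F vb := rfl
  rw [hFv]
  -- sign polarisation
  have hpol := sum_sign_smul_map_diag_eq_of_symmetric (R := ℝ) (M := bddMeas Ω) (N := ℝ) (n := m) F vb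
    (fun σ => mixedCoeffML_perm μ Xb m vb σ)
  -- each diagonal value is an `m`-th derivative of a tilted expectation, hence bounded
  have hdiag : ∀ ε : Fin m → Fin 2,
      |F (fun _ => ∑ j, (-1 : ℝ) ^ (ε j : ℕ) • vb j)| ≤ (m : ℝ) ^ m * (C₀ * C₁ ^ m * m.factorial) := by
    intro ε
    -- the normalised modulation `h_ε = (Σ εⱼ vⱼ)/m`
    set h : T := (m : ℝ)⁻¹ • ∑ j, (-1 : ℝ) ^ (ε j : ℕ) • v j with hh
    have hhA : h ∈ Adm := hAdm m v ε hv
    have hhD : Disj f₀ h := by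
      have := hDisj f₀ m v (fun j => (m : ℝ)⁻¹ * (-1 : ℝ) ^ (ε j : ℕ)) hd
      simpa only [hh, Finset.smul_sum, smul_smul] using this
    -- `Σ εⱼ vbⱼ = m • (m⁻¹ • Σ εⱼ vbⱼ)` inside the multilinear form
    set Wb : bddMeas Ω := ∑ j, (-1 : ℝ) ^ (ε j : ℕ) • vb j with hWb
    have hscale : F (fun _ => Wb) = (m : ℝ) ^ m * F (fun _ => (m : ℝ)⁻¹ • Wb) := by
      rcases Nat.eq_zero_or_pos m with hm | hm
      · subst hm
        simp only [pow_zero, one_mul]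
        congr 1
        funext i
        exact Fin.elim0 i
      · have h1 := F.map_smul_univ (fun _ : Fin m => (m : ℝ)) (fun _ => (m : ℝ)⁻¹ • Wb)
        have hm0 : (m : ℝ) ≠ 0 := by exact_mod_cast hm.ne'
        simp only [smul_smul, mul_inv_cancel₀ hm0, one_smul, prod_const, card_univ, Fintype.card_fin,
          smul_eq_mul] at h1
        exact h1
    -- the coerced function of `m⁻¹ • Wb` is `Φ h`
    have hcoe : (((m : ℝ)⁻¹ • Wb : bddMeas Ω) : Ω → ℝ) = Φ h := by
      rw [hh, hWb, map_smul, map_sum]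
      simp only [Submodule.coe_smul, Submodule.coe_sum, map_smul]
      rfl
    have hval : F (fun _ => (m : ℝ)⁻¹ • Wb) =
        iteratedDeriv m (fun t => ∫ ω, Φ f₀ ω ∂(μ.tilted (fun ω => t * Φ h ω))) 0 := by
      rw [hF, mixedCoeffML_apply]
      have := mixedCoeff_const_eq_iteratedDeriv (μ := μ) (hΦ f₀) (hΦ h)
        (Y := fun _ : Fin m => (((m : ℝ)⁻¹ • Wb : bddMeas Ω) : Ω → ℝ)) univ (fun i _ => hcoe)
      simpa only [card_univ, Fintype.card_fin] using this
    rw [hscale, abs_mul, abs_pow, Nat.abs_cast, hval]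
    exact mul_le_mul_of_nonneg_left (hbound f₀ h hf₀ hhA hhD m) (pow_nonneg (Nat.cast_nonneg m) m)
  -- combine
  have hfac : (0 : ℝ) < 2 ^ m * m.factorial := by positivity
  have hsum : |((2 : ℝ) ^ m * m.factorial) • F vb| ≤
      ∑ ε : Fin m → Fin 2, (m : ℝ) ^ m * (C₀ * C₁ ^ m * m.factorial) := by
    rw [← hpol]
    refine (abs_sum_le_sum_abs _ _).trans (sum_le_sum fun ε _ => ?_)
    rw [smul_eq_mul, abs_mul]
    have hsign : |∏ i, (-1 : ℝ) ^ (ε i : ℕ)| = 1 := by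
      rw [abs_prod]
      exact prod_eq_one fun i _ => by rw [abs_pow, abs_neg, abs_one, one_pow]
    rw [hsign, one_mul]
    exact hdiag ε
  rw [sum_const, card_univ, Fintype.card_fun, Fintype.card_fin, Fintype.card_fin, nsmul_eq_mul,
    smul_eq_mul, abs_mul, abs_of_pos hfac] at hsum
  have h2 : ((2 ^ m : ℕ) : ℝ) = (2 : ℝ) ^ m := by push_cast; ring
  rw [h2] at hsum
  -- `2^m m! |F vb| ≤ 2^m · m^m C₀ C₁^m m!`
  have hkey : |F vb| ≤ (m : ℝ) ^ m * (C₀ * C₁ ^ m) := by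
    have : (2 : ℝ) ^ m * m.factorial * |F vb| ≤ (2 : ℝ) ^ m * m.factorial * ((m : ℝ) ^ m * (C₀ * C₁ ^ m)) := by
      calc (2 : ℝ) ^ m * m.factorial * |F vb|
          ≤ (2 : ℝ) ^ m * ((m : ℝ) ^ m * (C₀ * C₁ ^ m * m.factorial)) := hsum
        _ = (2 : ℝ) ^ m * m.factorial * ((m : ℝ) ^ m * (C₀ * C₁ ^ m)) := by ring
    exact le_of_mul_le_mul_left this hfac
  calc |F vb| ≤ (m : ℝ) ^ m * (C₀ * C₁ ^ m) := hkey
    _ = C₀ * (C₁ * m) ^ m := by ring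

/-- **Moment bounds from tilted-derivative bounds** (abstract form of `stub_derivToMoments`).  Under the hypotheses
of `abs_mixedCoeff_le_of_tilted_deriv_bounds` (admissible set closed under normalised sign combinations, with
`0` admissible; disjointness closed under linear combinations), `k`-free bounds `C₀ C₁ⁿ n!` on all real
derivatives at `0` of the tilted one-point functions give, for every admissible pairwise-`Disj` family
`f : Fin n → T`, `|∫ ∏ᵢ Φ(fᵢ) dμ| ≤ Dⁿ n!` with `D = 2C₀ + 2e C₁ + 1`: the moment recursion
`∫ X ∏ Yᵢ = Σ_{t} A_X(t) ∫ ∏_{tᶜ} Yᵢ` with `|A_X(t)| ≤ C₀ (C₁|t|)^{|t|} ≤ C₀ (eC₁)^{|t|} |t|!` and induction on `n`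
(`Σ_j C(n,j) j! (n−j)! (eC₁)ʲ D^{n−j} ≤ 2 n! Dⁿ` once `2eC₁ ≤ D`). [folklore] -/
theorem abs_integral_prod_le_of_tilted_deriv_bounds (Φ : T →ₗ[ℝ] Ω → ℝ) (hΦ : ∀ f, IsBddMeas (Φ f))
    (Adm : Set T) (Disj : T → T → Prop)
    (hAdm : ∀ (m : ℕ) (v : Fin m → T) (ε : Fin m → Fin 2), (∀ i, v i ∈ Adm) →
      ((m : ℝ)⁻¹ • ∑ i, (-1 : ℝ) ^ (ε i : ℕ) • v i) ∈ Adm)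
    (hDisj : ∀ (f₀ : T) (m : ℕ) (v : Fin m → T) (c : Fin m → ℝ), (∀ i, Disj f₀ (v i)) →
      Disj f₀ (∑ i, c i • v i))
    {C₀ C₁ : ℝ} (hC₀ : 0 ≤ C₀) (hC₁ : 0 ≤ C₁)
    (hbound : ∀ f₀ f₁, f₀ ∈ Adm → f₁ ∈ Adm → Disj f₀ f₁ → ∀ n : ℕ,
      |iteratedDeriv n (fun t => ∫ ω, Φ f₀ ω ∂(μ.tilted (fun ω => t * Φ f₁ ω))) 0| ≤
        C₀ * C₁ ^ n * n.factorial) :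
    ∀ (n : ℕ) (f : Fin n → T), (∀ i, f i ∈ Adm) → (∀ i j, i ≠ j → Disj (f i) (f j)) →
      |∫ ω, ∏ i, Φ (f i) ω ∂μ| ≤ (2 * C₀ + 2 * Real.exp 1 * C₁ + 1) ^ n * n.factorial := by
  set D : ℝ := 2 * C₀ + 2 * Real.exp 1 * C₁ + 1 with hD
  have hD1 : 1 ≤ D := by rw [hD]; nlinarith [Real.exp_pos 1]
  have hD0 : 0 ≤ D := zero_le_one.trans hD1
  have hDC₀ : 2 * C₀ ≤ D := by rw [hD]; nlinarith [Real.exp_pos 1]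
  have hDC₁ : Real.exp 1 * C₁ ≤ D / 2 := by rw [hD]; nlinarith [Real.exp_pos 1]
  intro n
  induction n using Nat.strong_induction_on with
  | _ n ih =>
    intro f hfA hfD
    cases n with
    | zero => simp
    | succ n =>
      -- peel off `X = Φ (f 0)`
      simp_rw [Fin.prod_univ_succ]
      set X : Ω → ℝ := Φ (f 0) with hXdef
      set Y : Fin n → Ω → ℝ := fun j => Φ (f j.succ) with hYdef
      rw [integral_mul_prod_eq_sum_mixedCoeff μ X Y univ]
      -- bound each term of the moment recursion
      set g : ℕ → ℝ := fun j => C₀ * (Real.exp 1 * C₁) ^ j * j.factorial * (D ^ (n - j) * (n - j).factorial)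
        with hg
      have hterm : ∀ t ∈ (univ : Finset (Fin n)).powerset,
          |mixedCoeff μ X Y t * ∫ ω, ∏ i ∈ univ \ t, Y i ω ∂μ| ≤ g t.card := by
        intro t _
        rw [abs_mul]
        have hsplit : g t.card = (C₀ * (Real.exp 1 * C₁) ^ t.card * (t.card).factorial) *
            (D ^ (n - t.card) * (n - t.card).factorial) := by rw [hg]
        rw [hsplit]
        refine mul_le_mul ?_ ?_ (abs_nonneg _) (by positivity)
        · -- the mixed coefficient: transport to `Fin |t|` and polarise
          obtain ⟨e, he⟩ := exists_embedding_map_univ_eq t rfl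
          have htr := mixedCoeff_map (μ := μ) (X := X) e Y univ
          rw [he] at htr
          rw [htr]
          have hb := abs_mixedCoeff_le_of_tilted_deriv_bounds (μ := μ) Φ hΦ Adm Disj hAdm hDisj
            hbound (hfA 0) (m := t.card) (v := fun i => f (e i).succ) (fun i => hfA _)
            (fun i => hfD _ _ (Fin.succ_ne_zero _).symm)
          refine hb.trans ?_
          have hk : (C₁ * t.card) ^ t.card ≤ (Real.exp 1 * C₁) ^ t.card * (t.card).factorial :=
            calc (C₁ * t.card) ^ t.card = C₁ ^ t.card * (t.card : ℝ) ^ t.card := mul_pow _ _ _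
              _ ≤ C₁ ^ t.card * (Real.exp 1 ^ t.card * (t.card).factorial) :=
                  mul_le_mul_of_nonneg_left (Literature.NumberTheory.Transcendental.CW77.pow_self_le_exp_mul_factorial t.card) (pow_nonneg hC₁ _)
              _ = (Real.exp 1 * C₁) ^ t.card * (t.card).factorial := by rw [mul_pow]; ring
          calc C₀ * (C₁ * t.card) ^ t.card ≤ C₀ * ((Real.exp 1 * C₁) ^ t.card * (t.card).factorial) :=
                mul_le_mul_of_nonneg_left hk hC₀
            _ = C₀ * (Real.exp 1 * C₁) ^ t.card * (t.card).factorial := by ring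
        · -- the complementary moment: induction hypothesis on the sub-family
          have hcard : (univ \ t).card = n - t.card := by
            rw [card_sdiff_of_subset (subset_univ t), card_univ, Fintype.card_fin]
          obtain ⟨e, he⟩ := exists_embedding_map_univ_eq (univ \ t) hcard
          have hprod : ∀ ω, ∏ i ∈ univ \ t, Y i ω = ∏ j, Y (e j) ω := fun ω => by
            rw [← he, prod_map]
          simp_rw [hprod]
          have hlt : n - t.card < n + 1 := by omega
          have := ih _ hlt (fun j => f (e j).succ) (fun j => hfA _)
            (fun i j hij => hfD _ _ fun h => hij (e.injective (Fin.succ_injective _ h)))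
          exact this
      refine (abs_sum_le_sum_abs _ _).trans ((sum_le_sum hterm).trans ?_)
      rw [Finset.sum_powerset_apply_card g, card_univ, Fintype.card_fin]
      -- `Σ_j C(n,j) C₀ (eC₁)^j j! D^{n-j} (n-j)! = C₀ n! Σ_j (eC₁)^j D^{n-j} ≤ 2 C₀ n! Dⁿ ≤ D^{n+1} (n+1)!`
      have hrw : ∀ j ∈ range (n + 1), (n.choose j) • g j =
            C₀ * n.factorial * ((Real.exp 1 * C₁) ^ j * D ^ (n - j)) := by
        intro j hj
        have hjn : j ≤ n := Nat.lt_succ_iff.1 (mem_range.1 hj)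
        have hch : ((n.choose j : ℕ) : ℝ) * j.factorial * (n - j).factorial = n.factorial := by
          exact_mod_cast Nat.choose_mul_factorial_mul_factorial hjn
        rw [nsmul_eq_mul, ← hch, hg]
        ring
      rw [sum_congr rfl hrw, ← mul_sum]
      have hgeom : ∑ j ∈ range (n + 1), (Real.exp 1 * C₁) ^ j * D ^ (n - j) ≤ 2 * D ^ n := by
        calc ∑ j ∈ range (n + 1), (Real.exp 1 * C₁) ^ j * D ^ (n - j)
            ≤ ∑ j ∈ range (n + 1), (1 / 2 : ℝ) ^ j * D ^ n := by
              refine sum_le_sum fun j hj => ?_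
              have hjn : j ≤ n := Nat.lt_succ_iff.1 (mem_range.1 hj)
              calc (Real.exp 1 * C₁) ^ j * D ^ (n - j) ≤ (D / 2) ^ j * D ^ (n - j) :=
                    mul_le_mul_of_nonneg_right (pow_le_pow_left₀ (by positivity) hDC₁ j) (pow_nonneg hD0 _)
                _ = (1 / 2 : ℝ) ^ j * (D ^ j * D ^ (n - j)) := by rw [div_eq_mul_one_div, mul_pow]; ring
                _ = (1 / 2 : ℝ) ^ j * D ^ n := by rw [← pow_add, Nat.add_sub_cancel' hjn]
          _ = (∑ j ∈ range (n + 1), (1 / 2 : ℝ) ^ j) * D ^ n := by rw [sum_mul]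
          _ ≤ 2 * D ^ n := mul_le_mul_of_nonneg_right (sum_geometric_two_le _) (pow_nonneg hD0 n)
      calc C₀ * n.factorial * ∑ j ∈ range (n + 1), (Real.exp 1 * C₁) ^ j * D ^ (n - j)
          ≤ C₀ * n.factorial * (2 * D ^ n) := mul_le_mul_of_nonneg_left hgeom (by positivity)
        _ = (2 * C₀) * D ^ n * n.factorial := by ring
        _ ≤ D * D ^ n * (n + 1).factorial := by
            refine mul_le_mul (mul_le_mul_of_nonneg_right hDC₀ (pow_nonneg hD0 n)) ?_ (by positivity)
              (by positivity)
            exact_mod_cast Nat.factorial_le (Nat.le_succ n)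
        _ = D ^ (n + 1) * (n + 1).factorial := by ring

end Abstract

/-- **Registered sub-goal `tiltedMomentBounds` (line `Sketch`, stub `stub_derivToMoments`)**: closed form of
`abs_integral_prod_le_of_tilted_deriv_bounds`. [folklore] -/
theorem tiltedMomentBounds :
    ∀ (Ω : Type) [MeasurableSpace Ω] (μ : Measure Ω) [IsProbabilityMeasure μ] (T : Type) [AddCommGroup T] [Module ℝ T] (Φ : T →ₗ[ℝ] Ω → ℝ), (∀ f, IsBddMeas (Φ f)) → ∀ (Adm : Set T) (Disj : T → T → Prop), (∀ (m : ℕ) (v : Fin m → T) (ε : Fin m → Fin 2), (∀ i, v i ∈ Adm) → ((m : ℝ)⁻¹ • ∑ i, (-1 : ℝ) ^ (ε i : ℕ) • v i) ∈ Adm) → (∀ (f₀ : T) (m : ℕ) (v : Fin m → T) (c : Fin m → ℝ), (∀ i, Disj f₀ (v i)) → Disj f₀ (∑ i, c i • v i)) → ∀ (C₀ C₁ : ℝ), 0 ≤ C₀ → 0 ≤ C₁ → (∀ f₀ f₁, f₀ ∈ Adm → f₁ ∈ Adm → Disj f₀ f₁ → ∀ n : ℕ, |iteratedDeriv n (fun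 t => ∫ ω, Φ f₀ ω ∂(μ.tilted (fun ω => t * Φ f₁ ω))) 0| ≤ C₀ * C₁ ^ n * n.factorial) → ∀ (n : ℕ) (f : Fin n → T), (∀ i, f i ∈ Adm) → (∀ i j, i ≠ j → Disj (f i) (f j)) → |∫ ω, ∏ i, Φ (f i) ω ∂μ| ≤ (2 * C₀ + 2 * Real.exp 1 * C₁ + 1) ^ n * n.factorial :=
  fun _ _ μ _ _ _ _ Φ hΦ Adm Disj hAdm hDisj _ _ hC₀ hC₁ hbound =>
    abs_integral_prod_le_of_tilted_deriv_bounds (μ := μ) Φ hΦ Adm Disj hAdm hDisj hC₀ hC₁ hbound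

end Summit.QuantumFields.YangMills.Cruxes.HypercubicLimit.CouplingResponse

end
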